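import Literature.Geometry.Lorentzian.CarterConeFarCollar
import Literature.Geometry.Lorentzian.CarterFarBarrierEnvelope
import Literature.Geometry.Lorentzian.CarterThresholdTurningPointTortoise
import Literature.Analysis.ODE.BarrierDepth
import HarnessLib

/-!
# The κ-free good zone `r ∈ [r₊(1 + θ₁/8), r₊(1 + θ₁/4)]` of Carter's barrier in BF-stable sectors:
# coefficient floor, tortoise length, exponential depth and the reciprocal rates of the barrier basis
(namespace `Literature.Geometry.Lorentzian.Kerr`.)

Carter's radial equation `u″ + φu = 0`, `φ = ω² − V∘ρ` (`V = Kerr.sepPotential M a ω m Λ`, `ρ` a tortoise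
radius; DRSR arXiv:1402.7034 §5.2.3), in the threshold cone with a Breitenlohner–Freedman margin
`(1 + θ₁)(2r₊ω)² ≤ Λ′ := Λ − 2amω`, `0 < θ₁ ≤ 1`, and `σ := ω − mω₊` small against `Λ′`
(`18432 M²σ² ≤ θ₁⁴Λ′`; in the cone this is `ε₀ ≤ θ₁²/(1088 M)`, cf. `sigma_sq_le_of_cone_margin`). On the
κ-FREE radial zone `[r₊(1 + θ₁/8), r₊(1 + θ₁/4)]` the lower profile bound
`Kerr.sq_mul_negCoeff_ge_of_cone'` (`ε = θ₁/8`) gives a UNIFORM floor for the barrier coefficient, and its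
tortoise image is long:

* `negCoeff_ge_on_good_zone` — `θ₁³Λ′/(3584 r₊²) ≤ V(r) − ω²` on the zone;
* `exists_good_zone` — along a tortoise radius: `t₁ < t₂` with `ρ t₁ = r₊(1 + θ₁/8)`,
  `ρ t₂ = r₊(1 + θ₁/4)`, `t₂ − t₁ ≥ 2r₊/5` (`ρ′ ≤ Δ(ρ t₂)/(ρ t₁)² ≤ 5θ₁/16`,
  `IsTortoiseRadius.sub_le_mul_sub'`) and `k² := θ₁³Λ′/(3584 r₊²) ≤ V(ρ s) − ω²` on `[t₁, t₂]`;
* `carter_goodZone_depth_and_rates` — consequently (`Literature.Analysis.ODE.barrierBasis_depth_and_rates`),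
  once `89600 ≤ θ₁³Λ′` (so that `k(t₂ − t₁) ≥ 2`): whenever the forbidden set is `[b₁, b₂]`, EVERY monotone
  two-end real basis `g, d` of `y″ = (V∘ρ − ω²) y` on `[b₁, b₂]` (`w₀ = g′(b₂)`) has the EXPONENTIAL DEPTH
  `(k/4)·exp(2r₊k/5) ≤ w₀` — uniform in the surface gravity `κ` — and the reciprocal rates
  `d(b₁) ≤ (L + 2/k)·w₀` (`L = (25/κ)log(2496Λ/(σ²M²))`, the tame-zone length between the horizon zone
  and `7M`), `g(b₂) ≤ (200M/θ₁ + (7/5)R_f + 2/k)·w₀` (`ρ b₂ ≤ R_f`, `R_f ≥ 7M`), and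
  `g(x)d(x) ≤ (4/k)·w₀` for `ρ x` in the zone.

These are the `D`, `R_α`, `R_β` inputs (and the `R_m` input on the zone) of
`Kerr.carter_kernel_le_of_deep_barrier`; with `k ≍ θ₁^{3/2}√Λ′/r₊` the depth `e^{2r₊k/5} ≥ e^{θ₁^{3/2}√Λ′/150}`
beats every polynomial in `Λ` uniformly in `κ`. NOT here: the interior rate `R_m` off the zone (cap-edge
and far-edge Airy layers), the cap monotonicity/Sonin envelope, and the bookkeeping.

## References
* M. Dafermos, I. Rodnianski, Y. Shlapentokh-Rothman, arXiv:1402.7034 = Ann. of Math. 183 (2016),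
  §§2.1.2, 5.2.3, 6.2 (key `DafermosRodnianskiShlapentokhrothman2014`).
* P. Hartman, *Ordinary Differential Equations* (SIAM Classics 38, 2002), Ch. XI (key `Hartman2002`).
  The assembly is folklore.
-/

noncomputable section

open Set Literature.Analysis.ODE

namespace Literature.Geometry.Lorentzian

namespace Kerr

section GoodZone

variable {M a ω Λ : ℝ} {m : ℤ}

/-- **Coefficient floor on the good zone.** For `|a| < M`, `0 < θ₁ ≤ 1`, the margin
`(1 + θ₁)(2r₊ω)² ≤ Λ′` and `18432 M²σ² ≤ θ₁⁴Λ′`: `θ₁³Λ′/(3584 r₊²) ≤ V(r) − ω²` for every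
`r ∈ [r₊(1 + θ₁/8), r₊(1 + θ₁/4)]`. [folklore] -/
theorem negCoeff_ge_on_good_zone (ha : |a| < M) {θ₁ : ℝ} (hθ₁ : 0 < θ₁) (hθ₁1 : θ₁ ≤ 1)
    (hmargin : (1 + θ₁) * (2 * rPlus M a * ω) ^ 2 ≤ Λ - 2 * a * m * ω)
    (hσ : 18432 * M ^ 2 * (ω - m * horizonAngularVelocity M a) ^ 2 ≤ θ₁ ^ 4 * (Λ - 2 * a * m * ω))
    {r : ℝ} (hr1 : rPlus M a * (1 + θ₁ / 8) ≤ r) (hr2 : r ≤ rPlus M a * (1 + θ₁ / 4)) :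
    θ₁ ^ 3 * (Λ - 2 * a * m * ω) / (3584 * rPlus M a ^ 2) ≤ sepPotential M a ω m Λ r - ω ^ 2 := by
  have hM : 0 < M := lt_of_le_of_lt (abs_nonneg a) ha
  have haM : |a| ≤ M := ha.le
  set rp := rPlus M a with hrp
  set Λ' := Λ - 2 * a * m * ω with hΛ'
  set σ := ω - m * horizonAngularVelocity M a with hσdef
  have hrpM : M ≤ rp := M_le_rPlus M a
  have hrp0 : 0 < rp := hM.trans_le hrpM
  have hrr : rp < r := by
    have h := mul_lt_mul_of_pos_left (show (1 : ℝ) < 1 + θ₁ / 8 by linarith) hrp0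
    rw [mul_one] at h
    exact h.trans_le hr1
  have hr0 : 0 < r := hrp0.trans hrr
  have hΛ'0 : 0 ≤ Λ' := le_trans (by positivity) hmargin
  -- the profile lower bound at `r` with `ε = θ₁/8`
  have hε : 0 < θ₁ / 8 := by positivity
  have key := sq_mul_negCoeff_ge_of_cone' (ω := ω) (Λ := Λ) (m := m) ha hε hrr
  -- `Δ(r) ≥ (θ₁ rp/8)²`
  have hΔ : (θ₁ * rp / 8) ^ 2 ≤ delta M a r := by
    rw [delta_eq_mul haM r]
    have h1 : θ₁ * rp / 8 ≤ r - rp := by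
      have e : rp * (1 + θ₁ / 8) = rp + θ₁ * rp / 8 := by ring
      linarith
    have h2 : r - rp ≤ r - rMinus M a := by linarith [rMinus_le_rPlus M a]
    have h3 : 0 ≤ θ₁ * rp / 8 := by positivity
    calc (θ₁ * rp / 8) ^ 2 = (θ₁ * rp / 8) * (θ₁ * rp / 8) := sq _
      _ ≤ (r - rp) * (r - rMinus M a) := mul_le_mul h1 (h1.trans h2) h3 (h3.trans h1)
  -- the bracket: `Λ′ − (1 + θ₁/8)ω²(r + rp)² ≥ θ₁Λ′/4`
  have hbr : θ₁ / 4 * Λ' ≤ Λ' - (1 + θ₁ / 8) * (ω ^ 2 * (r + rp) ^ 2) := by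
    have e1 : (r + rp) ^ 2 ≤ (2 + θ₁ / 4) ^ 2 * rp ^ 2 := by
      have h1 : r + rp ≤ (2 + θ₁ / 4) * rp := by
        have e : (2 + θ₁ / 4) * rp = rp * (1 + θ₁ / 4) + rp := by ring
        linarith
      have h2 : 0 ≤ r + rp := by positivity
      calc (r + rp) ^ 2 ≤ ((2 + θ₁ / 4) * rp) ^ 2 := pow_le_pow_left₀ h2 h1 2
        _ = (2 + θ₁ / 4) ^ 2 * rp ^ 2 := by ring
    have hω : 4 * (1 + θ₁) * (ω ^ 2 * rp ^ 2) ≤ Λ' := by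
      calc 4 * (1 + θ₁) * (ω ^ 2 * rp ^ 2) = (1 + θ₁) * (2 * rp * ω) ^ 2 := by ring
        _ ≤ Λ' := hmargin
    have hpoly := farCollar_poly_le hθ₁.le hθ₁1
    have h0 : 0 ≤ ω ^ 2 * rp ^ 2 := by positivity
    have h1 : (1 + θ₁ / 8) * (ω ^ 2 * (r + rp) ^ 2) ≤ (1 - θ₁ / 4) * Λ' := by
      calc (1 + θ₁ / 8) * (ω ^ 2 * (r + rp) ^ 2)
          ≤ (1 + θ₁ / 8) * (ω ^ 2 * ((2 + θ₁ / 4) ^ 2 * rp ^ 2)) := by gcongr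
        _ = ((1 + θ₁ / 8) * (2 + θ₁ / 4) ^ 2) * (ω ^ 2 * rp ^ 2) := by ring
        _ ≤ (4 * (1 + θ₁) * (1 - θ₁ / 4)) * (ω ^ 2 * rp ^ 2) := mul_le_mul_of_nonneg_right hpoly h0
        _ = (1 - θ₁ / 4) * (4 * (1 + θ₁) * (ω ^ 2 * rp ^ 2)) := by ring
        _ ≤ (1 - θ₁ / 4) * Λ' := mul_le_mul_of_nonneg_left hω (by linarith)
    linarith
  -- the `σ²`-term
  have hA : rp ^ 2 + a ^ 2 = 2 * M * rp := rPlus_sq_add_sq haM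
  have hσterm : (1 + (θ₁ / 8)⁻¹) * ((rp ^ 2 + a ^ 2) * σ) ^ 2 ≤ 9 / θ₁ * (4 * M ^ 2 * rp ^ 2 * σ ^ 2) := by
    rw [hA]
    have h1 : (1 + (θ₁ / 8)⁻¹) ≤ 9 / θ₁ := by
      rw [inv_div, show (1 : ℝ) + 8 / θ₁ = (θ₁ + 8) / θ₁ by field_simp]
      exact div_le_div_of_nonneg_right (by linarith) hθ₁.le
    have h2 : (2 * M * rp * σ) ^ 2 = 4 * M ^ 2 * rp ^ 2 * σ ^ 2 := by ring
    rw [h2]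
    exact mul_le_mul_of_nonneg_right h1 (by positivity)
  -- assemble: the lower bound is at least `θ₁³ rp² Λ′/512`
  have hLB : θ₁ ^ 3 * rp ^ 2 * Λ' / 512 ≤ delta M a r * (Λ' - (1 + θ₁ / 8) * (ω ^ 2 * (r + rp) ^ 2)) -
      (1 + (θ₁ / 8)⁻¹) * ((rp ^ 2 + a ^ 2) * σ) ^ 2 := by
    have h1 : (θ₁ * rp / 8) ^ 2 * (θ₁ / 4 * Λ') ≤
        delta M a r * (Λ' - (1 + θ₁ / 8) * (ω ^ 2 * (r + rp) ^ 2)) :=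
      mul_le_mul hΔ hbr (by positivity) (delta_nonneg haM hrr.le)
    have h2 : 9 / θ₁ * (4 * M ^ 2 * rp ^ 2 * σ ^ 2) ≤ θ₁ ^ 3 * rp ^ 2 * Λ' / 512 := by
      rw [div_mul_eq_mul_div, div_le_iff₀ hθ₁]
      have : 9 * (4 * M ^ 2 * rp ^ 2 * σ ^ 2) * 512 ≤ θ₁ ^ 3 * rp ^ 2 * Λ' / 512 * θ₁ * 512 := by
        calc 9 * (4 * M ^ 2 * rp ^ 2 * σ ^ 2) * 512 = rp ^ 2 * (18432 * M ^ 2 * σ ^ 2) := by ring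
          _ ≤ rp ^ 2 * (θ₁ ^ 4 * Λ') := mul_le_mul_of_nonneg_left hσ (sq_nonneg _)
          _ = θ₁ ^ 3 * rp ^ 2 * Λ' / 512 * θ₁ * 512 := by ring
      linarith
    have e : (θ₁ * rp / 8) ^ 2 * (θ₁ / 4 * Λ') = θ₁ ^ 3 * rp ^ 2 * Λ' / 256 := by ring
    linarith
  -- `(r² + a²)² ≤ 7 rp⁴`
  have hA2 : (r ^ 2 + a ^ 2) ^ 2 ≤ 7 * rp ^ 4 := by
    have ha2 : a ^ 2 ≤ rp ^ 2 := by
      have : a ^ 2 ≤ M ^ 2 := by rw [← sq_abs]; exact pow_le_pow_left₀ (abs_nonneg a) haM 2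
      exact this.trans (pow_le_pow_left₀ hM.le hrpM 2)
    have hr2' : r ^ 2 ≤ (rp * (1 + θ₁ / 4)) ^ 2 := pow_le_pow_left₀ hr0.le hr2 2
    have h1 : r ^ 2 + a ^ 2 ≤ rp ^ 2 * ((1 + θ₁ / 4) ^ 2 + 1) := by
      have e : (rp * (1 + θ₁ / 4)) ^ 2 = rp ^ 2 * (1 + θ₁ / 4) ^ 2 := by ring
      rw [e] at hr2'
      have e2 : rp ^ 2 * ((1 + θ₁ / 4) ^ 2 + 1) = rp ^ 2 * (1 + θ₁ / 4) ^ 2 + rp ^ 2 := by ring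
      rw [e2]
      exact add_le_add hr2' ha2
    have h2 : (1 + θ₁ / 4) ^ 2 + 1 ≤ 2.5625 := by
      have h5 : (1 + θ₁ / 4) ^ 2 ≤ (1.25 : ℝ) ^ 2 :=
        pow_le_pow_left₀ (by positivity) (by linarith) 2
      norm_num at h5
      linarith
    have h3 : r ^ 2 + a ^ 2 ≤ 2.5625 * rp ^ 2 := by
      have := mul_le_mul_of_nonneg_left h2 (sq_nonneg rp)
      linarith
    have h4 : 0 ≤ r ^ 2 + a ^ 2 := by positivity
    have h5 : 0 ≤ rp ^ 4 := by positivity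
    calc (r ^ 2 + a ^ 2) ^ 2 ≤ (2.5625 * rp ^ 2) ^ 2 := pow_le_pow_left₀ h4 h3 2
      _ = 6.56640625 * rp ^ 4 := by ring
      _ ≤ 7 * rp ^ 4 := by linarith
  -- conclude
  have hpos : 0 < (r ^ 2 + a ^ 2) ^ 2 := by positivity
  have h := hLB.trans key
  rw [div_le_iff₀ (by positivity)]
  have hq : θ₁ ^ 3 * rp ^ 2 * Λ' / 512 ≤ (r ^ 2 + a ^ 2) ^ 2 * (sepPotential M a ω m Λ r - ω ^ 2) := h
  have hq0 : 0 ≤ sepPotential M a ω m Λ r - ω ^ 2 := by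
    by_contra hcon
    push Not at hcon
    have : (r ^ 2 + a ^ 2) ^ 2 * (sepPotential M a ω m Λ r - ω ^ 2) < 0 := mul_neg_of_pos_of_neg hpos hcon
    have : 0 ≤ θ₁ ^ 3 * rp ^ 2 * Λ' / 512 := by positivity
    linarith
  calc θ₁ ^ 3 * Λ' = θ₁ ^ 3 * rp ^ 2 * Λ' / 512 * 512 / rp ^ 2 := by field_simp
    _ ≤ (r ^ 2 + a ^ 2) ^ 2 * (sepPotential M a ω m Λ r - ω ^ 2) * 512 / rp ^ 2 := by gcongr
    _ ≤ 7 * rp ^ 4 * (sepPotential M a ω m Λ r - ω ^ 2) * 512 / rp ^ 2 := by gcongr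
    _ = (sepPotential M a ω m Λ r - ω ^ 2) * (3584 * rPlus M a ^ 2) := by rw [hrp]; field_simp; ring

variable {ρ : ℝ → ℝ}

/-- **The good zone in the tortoise variable.** Along a tortoise radius `ρ` of a sub-extremal exterior,
under the hypotheses of `negCoeff_ge_on_good_zone`, there are `t₁ < t₂` with `ρ t₁ = r₊(1 + θ₁/8)`,
`ρ t₂ = r₊(1 + θ₁/4)`, `t₂ − t₁ ≥ 2r₊/5`, and `θ₁³Λ′/(3584 r₊²) ≤ V(ρ s) − ω²` for all `s ∈ [t₁, t₂]`.
[folklore] -/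
theorem exists_good_zone (hρ : IsTortoiseRadius M a ρ) (hMa : IsSubextremal M a)
    {θ₁ : ℝ} (hθ₁ : 0 < θ₁) (hθ₁1 : θ₁ ≤ 1)
    (hmargin : (1 + θ₁) * (2 * rPlus M a * ω) ^ 2 ≤ Λ - 2 * a * m * ω)
    (hσ : 18432 * M ^ 2 * (ω - m * horizonAngularVelocity M a) ^ 2 ≤ θ₁ ^ 4 * (Λ - 2 * a * m * ω)) :
    ∃ t₁ t₂, t₁ < t₂ ∧ ρ t₁ = rPlus M a * (1 + θ₁ / 8) ∧ ρ t₂ = rPlus M a * (1 + θ₁ / 4) ∧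
      2 * rPlus M a / 5 ≤ t₂ - t₁ ∧
      ∀ s ∈ Icc t₁ t₂, θ₁ ^ 3 * (Λ - 2 * a * m * ω) / (3584 * rPlus M a ^ 2) ≤
        sepPotential M a ω m Λ (ρ s) - ω ^ 2 := by
  have hM : 0 < M := hMa.pos
  have ha : |a| < M := hMa
  set rp := rPlus M a with hrp
  have hrpM : M ≤ rp := M_le_rPlus M a
  have hrp0 : 0 < rp := rPlus_pos hM a
  have h1 : rp < rp * (1 + θ₁ / 8) := by
    have h := mul_lt_mul_of_pos_left (show (1 : ℝ) < 1 + θ₁ / 8 by linarith) hrp0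
    rwa [mul_one] at h
  have h2 : rp < rp * (1 + θ₁ / 4) := by
    have h := mul_lt_mul_of_pos_left (show (1 : ℝ) < 1 + θ₁ / 4 by linarith) hrp0
    rwa [mul_one] at h
  obtain ⟨t₁, ht₁⟩ := hρ.exists_apply_eq h1
  obtain ⟨t₂, ht₂⟩ := hρ.exists_apply_eq h2
  have hlt : t₁ < t₂ := by
    rw [← hρ.lt_iff_lt hMa, ht₁, ht₂]
    exact mul_lt_mul_of_pos_left (by linarith) hrp0
  refine ⟨t₁, t₂, hlt, ht₁, ht₂, ?_, fun s hs ↦ ?_⟩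
  · -- tortoise length: `ρ t₂ − ρ t₁ ≤ Δ(ρ t₂)/(ρ t₁² + a²)·(t₂ − t₁)` with the ratio `≤ 5θ₁/16`
    have hlen := hρ.sub_le_mul_sub' hMa hlt.le
    rw [ht₁, ht₂] at hlen
    have hΔ : delta M a (rp * (1 + θ₁ / 4)) ≤ 5 * θ₁ * rp ^ 2 / 16 := by
      rw [delta_eq_mul ha.le]
      have e1 : rp * (1 + θ₁ / 4) - rp = θ₁ * rp / 4 := by ring
      have e2 : rp * (1 + θ₁ / 4) - rMinus M a ≤ 5 * rp / 4 := by
        have h0 : 0 ≤ rMinus M a := by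
          unfold rMinus
          have hs : Real.sqrt (M ^ 2 - a ^ 2) ≤ M := by
            rw [Real.sqrt_le_left hM.le]; nlinarith [sq_nonneg a]
          linarith
        have h5 : rp * (1 + θ₁ / 4) ≤ rp * (5 / 4) := mul_le_mul_of_nonneg_left (by linarith) hrp0.le
        linarith
      have e3 : 0 ≤ rp * (1 + θ₁ / 4) - rMinus M a := by
        linarith [rMinus_le_rPlus M a]
      rw [e1]
      calc θ₁ * rp / 4 * (rp * (1 + θ₁ / 4) - rMinus M a) ≤ θ₁ * rp / 4 * (5 * rp / 4) :=
            mul_le_mul_of_nonneg_left e2 (by positivity)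
        _ = 5 * θ₁ * rp ^ 2 / 16 := by ring
    have hB : rp ^ 2 ≤ (rp * (1 + θ₁ / 8)) ^ 2 + a ^ 2 := by
      have h5 : rp ^ 2 ≤ (rp * (1 + θ₁ / 8)) ^ 2 := pow_le_pow_left₀ hrp0.le h1.le 2
      linarith [sq_nonneg a]
    have hratio : delta M a (rp * (1 + θ₁ / 4)) / ((rp * (1 + θ₁ / 8)) ^ 2 + a ^ 2) ≤ 5 * θ₁ / 16 := by
      rw [div_le_iff₀ (by positivity)]
      calc delta M a (rp * (1 + θ₁ / 4)) ≤ 5 * θ₁ * rp ^ 2 / 16 := hΔ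
        _ = 5 * θ₁ / 16 * rp ^ 2 := by ring
        _ ≤ 5 * θ₁ / 16 * ((rp * (1 + θ₁ / 8)) ^ 2 + a ^ 2) := by gcongr
    have hdiff : rp * (1 + θ₁ / 4) - rp * (1 + θ₁ / 8) = θ₁ * rp / 8 := by ring
    rw [hdiff] at hlen
    have h3 : θ₁ * rp / 8 ≤ 5 * θ₁ / 16 * (t₂ - t₁) :=
      hlen.trans (mul_le_mul_of_nonneg_right hratio (by linarith))
    have h4 : θ₁ * (2 * rp / 5) ≤ θ₁ * (t₂ - t₁) := by linarith
    exact le_of_mul_le_mul_left h4 hθ₁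
  · have hs1 : rp * (1 + θ₁ / 8) ≤ ρ s := by rw [← ht₁]; exact (hρ.strictMono hMa).monotone hs.1
    have hs2 : ρ s ≤ rp * (1 + θ₁ / 4) := by rw [← ht₂]; exact (hρ.strictMono hMa).monotone hs.2
    exact negCoeff_ge_on_good_zone ha hθ₁ hθ₁1 hmargin hσ hs1 hs2

set_option maxHeartbeats 400000 in
-- long hypothesis list (the barrier basis); the proof is plumbing around `barrierBasis_depth_and_rates`
/-- **Exponential depth and reciprocal rates of Carter's barrier basis from the good zone.** Along a
tortoise radius of a sub-extremal exterior (`|a| < M`, `Λ ≥ 1`, `σ = ω − mω₊ ≠ 0`), with `0 < θ₁ ≤ 1`,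
the margin, `18432 M²σ² ≤ θ₁⁴Λ′` and `89600 ≤ θ₁³Λ′`: if the forbidden set `{s | ω² − V(ρ s) ≤ 0}`
equals `[b₁, b₂]` with `x_a ≤ b₁` (`ρ x_a = r₊ + σ²M³/(416Λ)`) and `ρ b₂ ≤ R_f`, `R_f ≥ 7M`, then every
monotone two-end real basis `g, d` of `y″ = (V(ρ s) − ω²) y` on `[b₁, b₂]` (`w₀ = g′(b₂)`) satisfies, with
`k = √(θ₁³Λ′/(3584 r₊²))` and `L = (25/κ)log(2496Λ/(σ²M²))`:
`(k/4)·exp(2r₊k/5) ≤ w₀`, `d(b₁) ≤ (L + 2/k)·w₀`, `g(b₂) ≤ (200M/θ₁ + (7/5)R_f + 2/k)·w₀`, and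
`g(x)d(x) ≤ (4/k)·w₀` whenever `r₊(1 + θ₁/8) ≤ ρ x ≤ r₊(1 + θ₁/4)`. [folklore] -/
theorem carter_goodZone_depth_and_rates (hρ : IsTortoiseRadius M a ρ) (hMa : IsSubextremal M a)
    (hΛ : 1 ≤ Λ) (hσ0 : ω - m * horizonAngularVelocity M a ≠ 0)
    {θ₁ : ℝ} (hθ₁ : 0 < θ₁) (hθ₁1 : θ₁ ≤ 1)
    (hmargin : (1 + θ₁) * (2 * rPlus M a * ω) ^ 2 ≤ Λ - 2 * a * m * ω)
    (hσ : 18432 * M ^ 2 * (ω - m * horizonAngularVelocity M a) ^ 2 ≤ θ₁ ^ 4 * (Λ - 2 * a * m * ω))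
    (hΛ' : 89600 ≤ θ₁ ^ 3 * (Λ - 2 * a * m * ω))
    {b₁ b₂ xa Rf : ℝ} (hF : {s | ω ^ 2 - sepPotential M a ω m Λ (ρ s) ≤ 0} = Icc b₁ b₂)
    (hxa : ρ xa = rPlus M a + (ω - m * horizonAngularVelocity M a) ^ 2 * M ^ 3 / (416 * Λ))
    (hxab : xa ≤ b₁) (hRf : 7 * M ≤ Rf) (hb₂R : ρ b₂ ≤ Rf)
    {g g' d d' : ℝ → ℝ} {w₀ : ℝ}
    (hg : ∀ x ∈ Icc b₁ b₂, HasDerivAt g (g' x) x ∧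
      HasDerivAt g' (-(ω ^ 2 - sepPotential M a ω m Λ (ρ x)) * g x) x)
    (hd : ∀ x ∈ Icc b₁ b₂, HasDerivAt d (d' x) x ∧
      HasDerivAt d' (-(ω ^ 2 - sepPotential M a ω m Λ (ρ x)) * d x) x)
    (hgα : g b₁ = 1) (hg'α : g' b₁ = 0) (hg'β : g' b₂ = w₀)
    (hsign : ∀ x ∈ Icc b₁ b₂, 1 ≤ g x ∧ 0 ≤ g' x ∧ 1 ≤ d x ∧ d' x ≤ 0)
    (hW : ∀ x ∈ Icc b₁ b₂, g x * d' x - g' x * d x = -w₀) :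
    Real.sqrt (θ₁ ^ 3 * (Λ - 2 * a * m * ω) / (3584 * rPlus M a ^ 2)) / 4 *
        Real.exp (2 * rPlus M a *
          Real.sqrt (θ₁ ^ 3 * (Λ - 2 * a * m * ω) / (3584 * rPlus M a ^ 2)) / 5) ≤ w₀ ∧
    d b₁ ≤ (25 / surfaceGravity M a *
        Real.log (2496 * Λ / ((ω - m * horizonAngularVelocity M a) ^ 2 * M ^ 2)) +
        2 / Real.sqrt (θ₁ ^ 3 * (Λ - 2 * a * m * ω) / (3584 * rPlus M a ^ 2))) * w₀ ∧
    g b₂ ≤ (200 * M / θ₁ + 7 / 5 * Rf +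
        2 / Real.sqrt (θ₁ ^ 3 * (Λ - 2 * a * m * ω) / (3584 * rPlus M a ^ 2))) * w₀ ∧
    ∀ x, rPlus M a * (1 + θ₁ / 8) ≤ ρ x → ρ x ≤ rPlus M a * (1 + θ₁ / 4) →
      g x * d x ≤ 4 / Real.sqrt (θ₁ ^ 3 * (Λ - 2 * a * m * ω) / (3584 * rPlus M a ^ 2)) * w₀ := by
  have hM : 0 < M := hMa.pos
  set rp := rPlus M a with hrp
  set Λ' := Λ - 2 * a * m * ω with hΛ'def
  set σ := ω - m * horizonAngularVelocity M a with hσdef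
  set k := Real.sqrt (θ₁ ^ 3 * Λ' / (3584 * rp ^ 2)) with hk
  set q : ℝ → ℝ := fun s ↦ -(ω ^ 2 - sepPotential M a ω m Λ (ρ s)) with hq
  have hrpM : M ≤ rp := M_le_rPlus M a
  have hrp0 : 0 < rp := rPlus_pos hM a
  have hΛ'0 : 0 < Λ' := by
    by_contra hle
    push Not at hle
    have : θ₁ ^ 3 * Λ' ≤ 0 := mul_nonpos_of_nonneg_of_nonpos (by positivity) hle
    linarith
  have hk2 : k ^ 2 = θ₁ ^ 3 * Λ' / (3584 * rp ^ 2) := Real.sq_sqrt (by positivity)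
  have hk0 : 0 < k := Real.sqrt_pos.2 (by positivity)
  -- the good zone
  obtain ⟨t₁, t₂, hlt, ht₁, ht₂, hlen, hzone⟩ := exists_good_zone hρ hMa hθ₁ hθ₁1 hmargin hσ
  -- it lies inside the barrier
  have hin : ∀ s ∈ Icc t₁ t₂, s ∈ Icc b₁ b₂ := by
    intro s hs
    have h1 : 0 < θ₁ ^ 3 * Λ' / (3584 * rp ^ 2) := by positivity
    have h2 := hzone s hs
    have : s ∈ {s | ω ^ 2 - sepPotential M a ω m Λ (ρ s) ≤ 0} := by
      show ω ^ 2 - sepPotential M a ω m Λ (ρ s) ≤ 0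
      linarith
    rwa [hF] at this
  have hb₁t₁ : b₁ ≤ t₁ := (hin t₁ (left_mem_Icc.2 hlt.le)).1
  have ht₂b₂ : t₂ ≤ b₂ := (hin t₂ (right_mem_Icc.2 hlt.le)).2
  -- hypotheses of `barrierBasis_depth_and_rates`
  have hq0 : ∀ x ∈ Icc b₁ b₂, 0 ≤ q x := by
    intro x hx
    have : x ∈ {s | ω ^ 2 - sepPotential M a ω m Λ (ρ s) ≤ 0} := by rw [hF]; exact hx
    have h : ω ^ 2 - sepPotential M a ω m Λ (ρ x) ≤ 0 := this
    show 0 ≤ -(ω ^ 2 - sepPotential M a ω m Λ (ρ x))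
    linarith
  have hqk : ∀ s ∈ Icc t₁ t₂, k ^ 2 ≤ q s := by
    intro s hs
    rw [hk2]
    have := hzone s hs
    show θ₁ ^ 3 * Λ' / (3584 * rp ^ 2) ≤ -(ω ^ 2 - sepPotential M a ω m Λ (ρ s))
    linarith
  have hkℓ : 2 ≤ k * (t₂ - t₁) := by
    -- `k·(2rp/5) ≥ 2` iff `k rp ≥ 5` iff `k² rp² ≥ 25` iff `θ₁³Λ′ ≥ 89600`
    have h1 : 5 ≤ k * rp := by
      have h2 : (25 : ℝ) ≤ (k * rp) ^ 2 := by
        rw [mul_pow, hk2]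
        have e : θ₁ ^ 3 * Λ' / (3584 * rp ^ 2) * rp ^ 2 = θ₁ ^ 3 * Λ' / 3584 := by field_simp
        rw [e, le_div_iff₀ (by norm_num)]
        linarith
      have h3 : 0 ≤ k * rp := by positivity
      by_contra hcon
      push Not at hcon
      have h4 : (k * rp) ^ 2 < 5 ^ 2 := pow_lt_pow_left₀ hcon h3 two_ne_zero
      linarith
    calc (2 : ℝ) = 5 * (2 / 5) := by norm_num
      _ ≤ (k * rp) * (2 / 5) := by gcongr
      _ = k * (2 * rp / 5) := by ring
      _ ≤ k * (t₂ - t₁) := mul_le_mul_of_nonneg_left hlen hk0.le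
  obtain ⟨hdepth, hRα, hRβ, hRm⟩ := barrierBasis_depth_and_rates hg hd hq0 hgα hg'α hg'β hsign hW
    hb₁t₁ hlt ht₂b₂ hk0 hqk hkℓ
  have hw₀ : 0 ≤ w₀ := by
    rw [← hg'β]; exact (hsign b₂ (right_mem_Icc.2 (hb₁t₁.trans (hlt.le.trans ht₂b₂)))).2.1
  refine ⟨?_, ?_, ?_, fun x hx1 hx2 ↦ ?_⟩
  · -- depth: `exp(2rp k/5) ≤ exp(k(t₂ − t₁))`
    have h1 : Real.exp (2 * rp * k / 5) ≤ Real.exp (k * (t₂ - t₁)) := by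
      apply Real.exp_le_exp.2
      calc 2 * rp * k / 5 = k * (2 * rp / 5) := by ring
        _ ≤ k * (t₂ - t₁) := mul_le_mul_of_nonneg_left hlen hk0.le
    calc k / 4 * Real.exp (2 * rp * k / 5) ≤ k / 4 * Real.exp (k * (t₂ - t₁)) :=
          mul_le_mul_of_nonneg_left h1 (by positivity)
      _ ≤ w₀ := hdepth
  · -- `t₁ − b₁ ≤ t₁ − xa ≤ L`
    have hxat₁ : xa ≤ t₁ := hxab.trans hb₁t₁
    have ht₁7 : ρ t₁ ≤ 7 * M := by
      rw [ht₁]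
      have h2M : rp ≤ 2 * M := rPlus_le_two_mul_self hM.le a
      have h5 : rp * (1 + θ₁ / 8) ≤ rp * (9 / 8) := mul_le_mul_of_nonneg_left (by linarith) hrp0.le
      linarith
    have hL : t₁ - xa ≤ 25 / surfaceGravity M a * Real.log (2496 * Λ / (σ ^ 2 * M ^ 2)) :=
      hρ.tameZone_length_le hMa hσ0 hΛ hxa.ge hxat₁ ht₁7
    have h1 : (t₁ - b₁) + 2 / k ≤ 25 / surfaceGravity M a * Real.log (2496 * Λ / (σ ^ 2 * M ^ 2)) +
        2 / k := by linarith
    exact hRα.trans (mul_le_mul_of_nonneg_right h1 hw₀)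
  · -- `b₂ − t₂ ≤ 200M/θ₁ + (7/5)R_f`
    have ht₂r : ρ t₂ - rp = θ₁ * rp / 4 := by rw [ht₂]; ring
    have hnear : ∀ y, t₂ ≤ y → ρ y ≤ 7 * M → y - t₂ ≤ 200 * M / θ₁ := by
      intro y hy hy7
      have h1 := hρ.sub_le_div_sub_rPlus hMa hy hy7
      rw [ht₂r] at h1
      have h2 : 50 * M ^ 2 / (θ₁ * rp / 4) ≤ 200 * M / θ₁ := by
        rw [div_le_div_iff₀ (by positivity) hθ₁]
        calc 50 * M ^ 2 * θ₁ = (50 * M * θ₁) * M := by ring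
          _ ≤ (50 * M * θ₁) * rp := mul_le_mul_of_nonneg_left hrpM (by positivity)
          _ = 200 * M * (θ₁ * rp / 4) := by ring
      exact h1.trans h2
    have hfar : b₂ - t₂ ≤ 200 * M / θ₁ + 7 / 5 * Rf := by
      have hRf0 : 0 ≤ Rf := by linarith
      have h75 : 0 ≤ 7 / 5 * Rf := by positivity
      have h2M : rp ≤ 2 * M := rPlus_le_two_mul_self hM.le a
      rcases le_or_gt (ρ b₂) (7 * M) with h7 | h7
      · linarith [hnear b₂ ht₂b₂ h7]
      · have h7p : rp < 7 * M := by linarith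
        obtain ⟨x₇, hx₇⟩ := hρ.exists_apply_eq h7p
        have ht₂x₇ : t₂ ≤ x₇ := by
          rw [← hρ.le_iff_le hMa, hx₇, ht₂]
          have h5 : rp * (1 + θ₁ / 4) ≤ rp * (5 / 4) :=
            mul_le_mul_of_nonneg_left (by linarith) hrp0.le
          linarith
        have hx₇b₂ : x₇ ≤ b₂ := by
          rw [← hρ.le_iff_le hMa, hx₇]; exact h7.le
        have h1 := hnear x₇ ht₂x₇ hx₇.le
        have h2 : b₂ - x₇ ≤ 7 / 5 * (ρ b₂ - ρ x₇) := hρ.sub_le_mul_sub hMa hx₇b₂ hx₇.ge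
        have h3 : ρ b₂ - ρ x₇ ≤ Rf := by rw [hx₇]; linarith
        have h4 : 7 / 5 * (ρ b₂ - ρ x₇) ≤ 7 / 5 * Rf := by linarith
        linarith
    have h1 : (b₂ - t₂) + 2 / k ≤ 200 * M / θ₁ + 7 / 5 * Rf + 2 / k := by linarith
    exact hRβ.trans (mul_le_mul_of_nonneg_right h1 hw₀)
  · have hxI : x ∈ Icc t₁ t₂ := by
      constructor
      · rw [← hρ.le_iff_le hMa, ht₁]; exact hx1
      · rw [← hρ.le_iff_le hMa, ht₂]; exact hx2
    exact hRm x hxI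

end GoodZone

end Kerr

end Literature.Geometry.Lorentzian

end
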